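import Summits.QuantumFields.YangMills.Theorems.VirialFluxGapRingFrameDefs
import Literature.MathematicalPhysics.QuantumLattice.SU2HaarSmallBallUpper
import HarnessLib

/-!
# Route `VirialFluxGap` (YangMills): the RADIAL PROFILE `½·Im q` per variable — its frame derivatives and its EXACT divergence `(3/2)·Re q`

Companion of the `DF` package (✓`VirialFluxGapRingFrameDefs`, `…RingDeficitFrameDerivative`, `…RingPolyInsertion`) for the Euler-field
hypothesis of ✓`EulerFieldReduction.periodicSoftness_of_eulerField` (item stmt-QuantumFields-24141).  The proposed coefficient fields (LEAD
ym-line-sfw-p2 g92, design note №2 on the cell bus; the central charts' `¼·P_z Im` block) use, variable by variable, the RADIAL PROFILE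
`φ_{v,a}(P) = ½·Im_a(q(P_v))` (`q = su2Quat`, the unit quaternion of the variable) against the frame directions `Y_a = quatMatrix(e_a)`,
`e_a ∈ {i, j, k}`.  In the ambient-coordinate language of the `DF` package these profiles are CONTINUOUS LINEAR functionals of the coordinates,
so everything is exact:

* §1 the directions: `quatMatrix` of a pure imaginary quaternion is skew-Hermitian and traceless (`quatMatrix_im_conjTranspose`,
  `quatMatrix_im_trace`) — admissible `Y` for `sliceCurve ∕ seamCurve`;
* §2 the profile functionals `M ↦ Im₁∕Im₂∕Im₃` of a slice ∕ seam coordinate (first-row entries) as continuous linear maps; their value on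
  `ringCoord P` is `Im_a(su2Quat P_v)` (`rfl`), they are `C^∞`, and their Fréchet derivative is themselves;
* §3 ★★ `slice_profile_frameDeriv` ∕ `seam_profile_frameDeriv` — along the frame direction `(v, quatMatrix p)` (`p` pure imaginary) the
  derivative of `Im_a(q(P_v))` is `Im_a(q(P_v)·p)` (✓`quatMatrix_mul`, ✓`quatMatrix_su2Quat`); other variables contribute `0`
  (`slice_profile_frameDeriv_of_ne`);
* §4 ★★★ `slice_profile_div` ∕ `seam_profile_div` — the TRACE over the quaternion units: `Im₁(q·i) + Im₂(q·j) + Im₃(q·k) = 3·Re q`, hence the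
  per-variable Haar divergence of `½·Im` is `(3/2)·Re q(P_v) ≤ 3/2` with `|·| ≤ 3/2` (`abs_profile_div_le`) — the «good sign, no arccos∕sinc»
  bookkeeping of design note №2, β-free and exact.

HONEST FRAMING: linear-algebra bookkeeping; no coefficient field is assembled and neither pointwise inequality of the Euler field is proved here;
⟨24141⟩ stays OPEN; the Yang–Mills mass gap is NOT proved; no summit is proved by a line.  THEOREMS ONLY (0 `def`, 0 `sorry`), standard axioms.
Width seat `ym-line-sfw-p2-w3` g58 (cell ym-idea-1, free hands), `--supports stmt-QuantumFields-24141`.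
References: [cite: arXiv220412737, §2 (2.4) (p. 10)]; [cite: Luscher1983, §2].
-/

set_option autoImplicit false

noncomputable section

open scoped Matrix BigOperators ContDiff Topology Quaternion
open Literature.MathematicalPhysics.QuantumFieldTheory hiding SU2
open Literature.MathematicalPhysics.QuantumLattice
open Literature.MathematicalPhysics.QuantumFieldTheory.SUNBakryEmery (matTop)

namespace Summit.QuantumFields.YangMills.Theorems.VirialFluxGap.FrameDerivative

open Summit.QuantumFields.YangMills.Theorems.FemtoTransferGap

variable {L : ℕ} [NeZero L]

open scoped Matrix.Norms.Frobenius

attribute [local instance 2000] Literature.MathematicalPhysics.QuantumFieldTheory.SUNBakryEmery.matTop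

/-! ## §1 Pure imaginary quaternions give admissible frame directions -/

section Directions

omit [NeZero L]

/-- `quatMatrix` of a pure imaginary quaternion is skew-Hermitian. [folklore] -/
theorem quatMatrix_im_conjTranspose (x y z : ℝ) : (quatMatrix ⟨0, x, y, z⟩)ᴴ = -quatMatrix ⟨0, x, y, z⟩ := by
  ext i j
  fin_cases i <;> fin_cases j <;>
    simp [quatMatrix, Matrix.conjTranspose_apply, Complex.ext_iff]

/-- `quatMatrix` of a pure imaginary quaternion is traceless. [folklore] -/
theorem quatMatrix_im_trace (x y z : ℝ) : (quatMatrix ⟨0, x, y, z⟩).trace = 0 := by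
  rw [Matrix.trace_fin_two, quatMatrix_apply_00, quatMatrix_apply_11]
  apply Complex.ext <;> simp

/-- A slice coordinate of a ring history times a quaternion matrix is the matrix of the product quaternion. [folklore] -/
theorem coe_mul_quatMatrix (U : SU2) (p : ℍ) : (U : Matrix (Fin 2) (Fin 2) ℂ) * quatMatrix p = quatMatrix (su2Quat U * p) := by
  rw [quatMatrix_mul, quatMatrix_su2Quat]

end Directions

/-! ## §2 The profile functionals are continuous linear -/

/-- The first-row entry functionals of a slice coordinate, as real-linear maps: `Im₁ = Im M₀₀`, `Im₂ = Re M₀₁`, `Im₃ = Im M₀₁`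
(on `ringCoord P` these are the three imaginary parts of `su2Quat (P.1 i e)`). [folklore] -/
theorem exists_slice_profile_clm (i : Fin (2 * L - 1 + 1)) (e : Edge 3 L) :
    ∃ ℓ₁ ℓ₂ ℓ₃ : ((Fin (2 * L - 1 + 1) → Edge 3 L → Matrix (Fin 2) (Fin 2) ℂ) × (Site 3 L → Matrix (Fin 2) (Fin 2) ℂ)) →L[ℝ] ℝ,
      (∀ M, ℓ₁ M = ((M.1 i e) 0 0).im) ∧ (∀ M, ℓ₂ M = ((M.1 i e) 0 1).re) ∧ (∀ M, ℓ₃ M = ((M.1 i e) 0 1).im) := by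
  refine ⟨LinearMap.toContinuousLinearMap
      { toFun := fun M => ((M.1 i e) 0 0).im, map_add' := fun M N => by simp, map_smul' := fun c M => by simp },
    LinearMap.toContinuousLinearMap
      { toFun := fun M => ((M.1 i e) 0 1).re, map_add' := fun M N => by simp, map_smul' := fun c M => by simp },
    LinearMap.toContinuousLinearMap
      { toFun := fun M => ((M.1 i e) 0 1).im, map_add' := fun M N => by simp, map_smul' := fun c M => by simp },
    fun M => rfl, fun M => rfl, fun M => rfl⟩

/-- The first-row entry functionals of a seam coordinate, as real-linear maps. [folklore] -/
theorem exists_seam_profile_clm (x : Site 3 L) :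
    ∃ ℓ₁ ℓ₂ ℓ₃ : ((Fin (2 * L - 1 + 1) → Edge 3 L → Matrix (Fin 2) (Fin 2) ℂ) × (Site 3 L → Matrix (Fin 2) (Fin 2) ℂ)) →L[ℝ] ℝ,
      (∀ M, ℓ₁ M = ((M.2 x) 0 0).im) ∧ (∀ M, ℓ₂ M = ((M.2 x) 0 1).re) ∧ (∀ M, ℓ₃ M = ((M.2 x) 0 1).im) := by
  refine ⟨LinearMap.toContinuousLinearMap
      { toFun := fun M => ((M.2 x) 0 0).im, map_add' := fun M N => by simp, map_smul' := fun c M => by simp },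
    LinearMap.toContinuousLinearMap
      { toFun := fun M => ((M.2 x) 0 1).re, map_add' := fun M N => by simp, map_smul' := fun c M => by simp },
    LinearMap.toContinuousLinearMap
      { toFun := fun M => ((M.2 x) 0 1).im, map_add' := fun M N => by simp, map_smul' := fun c M => by simp },
    fun M => rfl, fun M => rfl, fun M => rfl⟩

/-- The profile functionals evaluated on a ring history are the imaginary parts of the variable's quaternion. [folklore] -/
theorem slice_profile_ringCoord (i : Fin (2 * L - 1 + 1)) (e : Edge 3 L) (P : (Fin (2 * L - 1 + 1) → GaugeConfig 3 L SU2) × (Site 3 L → SU2)) :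
    (((ringCoord L P).1 i e) 0 0).im = (su2Quat (P.1 i e)).imI ∧ (((ringCoord L P).1 i e) 0 1).re = (su2Quat (P.1 i e)).imJ ∧
      (((ringCoord L P).1 i e) 0 1).im = (su2Quat (P.1 i e)).imK := ⟨rfl, rfl, rfl⟩

/-- The same for a seam variable. [folklore] -/
theorem seam_profile_ringCoord (x : Site 3 L) (P : (Fin (2 * L - 1 + 1) → GaugeConfig 3 L SU2) × (Site 3 L → SU2)) :
    (((ringCoord L P).2 x) 0 0).im = (su2Quat (P.2 x)).imI ∧ (((ringCoord L P).2 x) 0 1).re = (su2Quat (P.2 x)).imJ ∧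
      (((ringCoord L P).2 x) 0 1).im = (su2Quat (P.2 x)).imK := ⟨rfl, rfl, rfl⟩

/-! ## §3 Frame derivatives of the profile functionals -/

omit [NeZero L] in
/-- `sliceDir` on its own variable is the direction. [folklore] -/
theorem sliceDir_self (i : Fin (2 * L - 1 + 1)) (e : Edge 3 L) (Y : Matrix (Fin 2) (Fin 2) ℂ) : sliceDir i e Y i e = Y := by
  simp [sliceDir]

omit [NeZero L] in
/-- `sliceDir` vanishes on other variables. [folklore] -/
theorem sliceDir_of_ne {i i' : Fin (2 * L - 1 + 1)} {e e' : Edge 3 L} (Y : Matrix (Fin 2) (Fin 2) ℂ) (h : ¬(i' = i ∧ e' = e)) :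
    sliceDir i e Y i' e' = 0 := by
  simp [sliceDir, h]

omit [NeZero L] in
/-- `seamDir` on its own variable is the direction. [folklore] -/
theorem seamDir_self (x : Site 3 L) (Y : Matrix (Fin 2) (Fin 2) ℂ) : seamDir x Y x = Y := by
  simp [seamDir]

omit [NeZero L] in
/-- `seamDir` vanishes on other variables. [folklore] -/
theorem seamDir_of_ne {x x' : Site 3 L} (Y : Matrix (Fin 2) (Fin 2) ℂ) (h : x' ≠ x) : seamDir x Y x' = 0 := by
  simp [seamDir, h]

/-- ★★ **Frame derivative of the slice profile along its own variable**: for a continuous linear functional `ℓ` of the coordinates that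
reads the `(i,e)` slice coordinate through a first-row entry, and a pure imaginary direction `p`, `Dℓ(ringCoord P)[sliceTangent_{(i,e), quatMatrix p} P]`
is the corresponding imaginary part of `su2Quat(P_{i,e})·p`. [cite: arXiv220412737, §2 (2.4) (p. 10)] -/
theorem slice_profile_frameDeriv (i : Fin (2 * L - 1 + 1)) (e : Edge 3 L) (p : ℍ)
    (P : (Fin (2 * L - 1 + 1) → GaugeConfig 3 L SU2) × (Site 3 L → SU2))
    (ℓ : ((Fin (2 * L - 1 + 1) → Edge 3 L → Matrix (Fin 2) (Fin 2) ℂ) × (Site 3 L → Matrix (Fin 2) (Fin 2) ℂ)) →L[ℝ] ℝ) :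
    ((∀ M, ℓ M = ((M.1 i e) 0 0).im) →
        fderiv ℝ ℓ (ringCoord L P) (sliceTangent i e (quatMatrix p) P) = (su2Quat (P.1 i e) * p).imI) ∧
    ((∀ M, ℓ M = ((M.1 i e) 0 1).re) →
        fderiv ℝ ℓ (ringCoord L P) (sliceTangent i e (quatMatrix p) P) = (su2Quat (P.1 i e) * p).imJ) ∧
    ((∀ M, ℓ M = ((M.1 i e) 0 1).im) →
        fderiv ℝ ℓ (ringCoord L P) (sliceTangent i e (quatMatrix p) P) = (su2Quat (P.1 i e) * p).imK) := by
  have htan : (sliceTangent i e (quatMatrix p) P).1 i e = quatMatrix (su2Quat (P.1 i e) * p) := by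
    simp only [sliceTangent, sliceDir_self, coe_mul_quatMatrix]
  refine ⟨fun hℓ => ?_, fun hℓ => ?_, fun hℓ => ?_⟩ <;>
  · rw [ℓ.fderiv, hℓ, htan]
    simp

/-- The slice profile of the variable `(i,e)` has derivative `0` along the frame direction of ANY OTHER slice variable. [folklore] -/
theorem slice_profile_frameDeriv_of_ne {i i' : Fin (2 * L - 1 + 1)} {e e' : Edge 3 L} (h : ¬(i = i' ∧ e = e')) (Y : Matrix (Fin 2) (Fin 2) ℂ)
    (P : (Fin (2 * L - 1 + 1) → GaugeConfig 3 L SU2) × (Site 3 L → SU2))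
    (ℓ : ((Fin (2 * L - 1 + 1) → Edge 3 L → Matrix (Fin 2) (Fin 2) ℂ) × (Site 3 L → Matrix (Fin 2) (Fin 2) ℂ)) →L[ℝ] ℝ)
    (hℓ : (∀ M, ℓ M = ((M.1 i e) 0 0).im) ∨ (∀ M, ℓ M = ((M.1 i e) 0 1).re) ∨ (∀ M, ℓ M = ((M.1 i e) 0 1).im)) :
    fderiv ℝ ℓ (ringCoord L P) (sliceTangent i' e' Y P) = 0 := by
  have htan : (sliceTangent i' e' Y P).1 i e = 0 := by
    simp only [sliceTangent, sliceDir_of_ne Y h, Matrix.mul_zero]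
  rcases hℓ with hℓ | hℓ | hℓ <;>
  · rw [ℓ.fderiv, hℓ, htan]; simp

/-- The slice profile has derivative `0` along every seam direction. [folklore] -/
theorem slice_profile_frameDeriv_seam (i : Fin (2 * L - 1 + 1)) (e : Edge 3 L) (x : Site 3 L) (Y : Matrix (Fin 2) (Fin 2) ℂ)
    (P : (Fin (2 * L - 1 + 1) → GaugeConfig 3 L SU2) × (Site 3 L → SU2))
    (ℓ : ((Fin (2 * L - 1 + 1) → Edge 3 L → Matrix (Fin 2) (Fin 2) ℂ) × (Site 3 L → Matrix (Fin 2) (Fin 2) ℂ)) →L[ℝ] ℝ)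
    (hℓ : (∀ M, ℓ M = ((M.1 i e) 0 0).im) ∨ (∀ M, ℓ M = ((M.1 i e) 0 1).re) ∨ (∀ M, ℓ M = ((M.1 i e) 0 1).im)) :
    fderiv ℝ ℓ (ringCoord L P) (seamTangent x Y P) = 0 := by
  have htan : (seamTangent x Y P).1 i e = 0 := rfl
  rcases hℓ with hℓ | hℓ | hℓ <;>
  · rw [ℓ.fderiv, hℓ, htan]; simp

/-- ★★ **Frame derivative of the seam profile along its own variable.** [cite: arXiv220412737, §2 (2.4) (p. 10)] -/
theorem seam_profile_frameDeriv (x : Site 3 L) (p : ℍ)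
    (P : (Fin (2 * L - 1 + 1) → GaugeConfig 3 L SU2) × (Site 3 L → SU2))
    (ℓ : ((Fin (2 * L - 1 + 1) → Edge 3 L → Matrix (Fin 2) (Fin 2) ℂ) × (Site 3 L → Matrix (Fin 2) (Fin 2) ℂ)) →L[ℝ] ℝ) :
    ((∀ M, ℓ M = ((M.2 x) 0 0).im) → fderiv ℝ ℓ (ringCoord L P) (seamTangent x (quatMatrix p) P) = (su2Quat (P.2 x) * p).imI) ∧
    ((∀ M, ℓ M = ((M.2 x) 0 1).re) → fderiv ℝ ℓ (ringCoord L P) (seamTangent x (quatMatrix p) P) = (su2Quat (P.2 x) * p).imJ) ∧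
    ((∀ M, ℓ M = ((M.2 x) 0 1).im) → fderiv ℝ ℓ (ringCoord L P) (seamTangent x (quatMatrix p) P) = (su2Quat (P.2 x) * p).imK) := by
  have htan : (seamTangent x (quatMatrix p) P).2 x = quatMatrix (su2Quat (P.2 x) * p) := by
    simp only [seamTangent, seamDir_self, coe_mul_quatMatrix]
  refine ⟨fun hℓ => ?_, fun hℓ => ?_, fun hℓ => ?_⟩ <;>
  · rw [ℓ.fderiv, hℓ, htan]
    simp

/-- The seam profile has derivative `0` along the other seam variables and along every slice direction. [folklore] -/
theorem seam_profile_frameDeriv_of_ne (x : Site 3 L) (P : (Fin (2 * L - 1 + 1) → GaugeConfig 3 L SU2) × (Site 3 L → SU2))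
    (ℓ : ((Fin (2 * L - 1 + 1) → Edge 3 L → Matrix (Fin 2) (Fin 2) ℂ) × (Site 3 L → Matrix (Fin 2) (Fin 2) ℂ)) →L[ℝ] ℝ)
    (hℓ : (∀ M, ℓ M = ((M.2 x) 0 0).im) ∨ (∀ M, ℓ M = ((M.2 x) 0 1).re) ∨ (∀ M, ℓ M = ((M.2 x) 0 1).im)) (Y : Matrix (Fin 2) (Fin 2) ℂ) :
    (∀ x' : Site 3 L, x ≠ x' → fderiv ℝ ℓ (ringCoord L P) (seamTangent x' Y P) = 0) ∧
    (∀ (i : Fin (2 * L - 1 + 1)) (e : Edge 3 L), fderiv ℝ ℓ (ringCoord L P) (sliceTangent i e Y P) = 0) := by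
  refine ⟨fun x' hx => ?_, fun i e => ?_⟩
  · have htan : (seamTangent x' Y P).2 x = 0 := by
      simp only [seamTangent, seamDir_of_ne Y hx, Matrix.mul_zero]
    rcases hℓ with hℓ | hℓ | hℓ <;>
    · rw [ℓ.fderiv, hℓ, htan]; simp
  · have htan : (sliceTangent i e Y P).2 x = 0 := rfl
    rcases hℓ with hℓ | hℓ | hℓ <;>
    · rw [ℓ.fderiv, hℓ, htan]; simp

/-! ## §4 The trace over the quaternion units: the exact per-variable divergence -/

section Trace

omit [NeZero L]

/-- ★ **Quaternion bookkeeping**: `Im₁(q·i) + Im₂(q·j) + Im₃(q·k) = 3·Re q`. [folklore] -/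
theorem im_mul_units_sum (q : ℍ) :
    (q * ⟨0, 1, 0, 0⟩).imI + (q * ⟨0, 0, 1, 0⟩).imJ + (q * ⟨0, 0, 0, 1⟩).imK = 3 * q.re := by
  simp only [Quaternion.imI_mul, Quaternion.imJ_mul, Quaternion.imK_mul]
  ring

/-- The real part of a unit quaternion is at most `1` in absolute value. [folklore] -/
theorem abs_re_su2Quat_le (U : SU2) : |(su2Quat U).re| ≤ 1 := by
  have h := abs_re_le_norm (su2Quat U)
  rwa [norm_su2Quat] at h

end Trace

/-- ★★★ **The exact per-variable divergence of the radial profile (slice variable).**  With the three profile functionals `ℓ₁, ℓ₂, ℓ₃` of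
the variable `(i,e)` and the three unit directions `quatMatrix i ∕ j ∕ k`:
`Dℓ₁[tangent_i] + Dℓ₂[tangent_j] + Dℓ₃[tangent_k] = 3·Re(su2Quat P_{i,e})`, so the field `Σ_a ½ℓ_a ∂_{(i,e),a}` has Haar divergence
`(3/2)·Re q ≤ 3/2` per variable, and all other variables' profiles are transparent to these directions. [cite: arXiv220412737, §2 (2.4) (p. 10)] -/
theorem slice_profile_div (i : Fin (2 * L - 1 + 1)) (e : Edge 3 L) (P : (Fin (2 * L - 1 + 1) → GaugeConfig 3 L SU2) × (Site 3 L → SU2))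
    (ℓ₁ ℓ₂ ℓ₃ : ((Fin (2 * L - 1 + 1) → Edge 3 L → Matrix (Fin 2) (Fin 2) ℂ) × (Site 3 L → Matrix (Fin 2) (Fin 2) ℂ)) →L[ℝ] ℝ)
    (h₁ : ∀ M, ℓ₁ M = ((M.1 i e) 0 0).im) (h₂ : ∀ M, ℓ₂ M = ((M.1 i e) 0 1).re) (h₃ : ∀ M, ℓ₃ M = ((M.1 i e) 0 1).im) :
    fderiv ℝ ℓ₁ (ringCoord L P) (sliceTangent i e (quatMatrix ⟨0, 1, 0, 0⟩) P) +
      fderiv ℝ ℓ₂ (ringCoord L P) (sliceTangent i e (quatMatrix ⟨0, 0, 1, 0⟩) P) +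
      fderiv ℝ ℓ₃ (ringCoord L P) (sliceTangent i e (quatMatrix ⟨0, 0, 0, 1⟩) P) = 3 * (su2Quat (P.1 i e)).re := by
  rw [(slice_profile_frameDeriv i e _ P ℓ₁).1 h₁, (slice_profile_frameDeriv i e _ P ℓ₂).2.1 h₂, (slice_profile_frameDeriv i e _ P ℓ₃).2.2 h₃]
  exact im_mul_units_sum _

/-- ★★★ **The exact per-variable divergence of the radial profile (seam variable).** [cite: arXiv220412737, §2 (2.4) (p. 10)] -/
theorem seam_profile_div (x : Site 3 L) (P : (Fin (2 * L - 1 + 1) → GaugeConfig 3 L SU2) × (Site 3 L → SU2))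
    (ℓ₁ ℓ₂ ℓ₃ : ((Fin (2 * L - 1 + 1) → Edge 3 L → Matrix (Fin 2) (Fin 2) ℂ) × (Site 3 L → Matrix (Fin 2) (Fin 2) ℂ)) →L[ℝ] ℝ)
    (h₁ : ∀ M, ℓ₁ M = ((M.2 x) 0 0).im) (h₂ : ∀ M, ℓ₂ M = ((M.2 x) 0 1).re) (h₃ : ∀ M, ℓ₃ M = ((M.2 x) 0 1).im) :
    fderiv ℝ ℓ₁ (ringCoord L P) (seamTangent x (quatMatrix ⟨0, 1, 0, 0⟩) P) +
      fderiv ℝ ℓ₂ (ringCoord L P) (seamTangent x (quatMatrix ⟨0, 0, 1, 0⟩) P) +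
      fderiv ℝ ℓ₃ (ringCoord L P) (seamTangent x (quatMatrix ⟨0, 0, 0, 1⟩) P) = 3 * (su2Quat (P.2 x)).re := by
  rw [(seam_profile_frameDeriv x _ P ℓ₁).1 h₁, (seam_profile_frameDeriv x _ P ℓ₂).2.1 h₂, (seam_profile_frameDeriv x _ P ℓ₃).2.2 h₃]
  exact im_mul_units_sum _

/-- ★ The per-variable divergence is bounded by `3` in absolute value (so `½·` it is `≤ 3/2`). [folklore] -/
theorem abs_profile_div_le (U : SU2) : |3 * (su2Quat U).re| ≤ 3 := by
  rw [abs_mul, abs_of_pos (by norm_num : (0 : ℝ) < 3)]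
  have := abs_re_su2Quat_le U
  linarith

end Summit.QuantumFields.YangMills.Theorems.VirialFluxGap.FrameDerivative

end
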